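import Literature.MathematicalPhysics.QuantumFieldTheory.Balaban1983to89.B7Ineq149Pairing

/-!
# `Balaban1983to89.B7Eq136SecondOrder` — T. Bałaban, *Averaging operations for lattice gauge theories*, Commun. Math. Phys. **98**
(1985) 17–51 [Balaban1985Averaging], (136) p. 39: **THE SECOND-ORDER TERM `C_j⁽²⁾(U₀, ·)` OF THE REMAINDER `C_j(U₀, ·)` ON THE
CONCRETE `ℤᵈ` CARRIER, ITS POLARIZATION, AND THE INEQUALITY (149) FOR IT** — the object that [B9] (3.127)/(3.136) and [B11] (56)
take from [B7]: «a second order term in the expansion of Q_j(ηA)»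

statement-level skeleton of published theorems with citation tags; proofs where landed; nothing here is a claim about the Yang–Mills mass gap

PDF held: `paper:balaban1985-cmp98-averaging` (journal page = PDF page + 16), renders `…/1985-cmp98-averaging-p022-x2.png`–`p024-x2.png`
(pp. 38–40) read as images; `paper:balaban1985-cmp99-background-propagators` (journal page = PDF page + 388), renders
`…/1985-cmp99-background-propagators-p033-x2.png`, `-p034-x2.png` (pp. 421–422) read as images; `paper:balaban1985-cmp102-variational-background`
p. 286 [PDF 10] (text layer `p0010.txt`).

CITATION HEADER / WHAT IS REPRODUCED.  Cell `lit-balaban` (HOME `run/shared/lean/pub/lit-balaban/`), Phase-2 proof seat p06 gen 5 = unit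
`lit-balaban-p06` (TAKING line HOME/STATUS.md 2026-08-21T07:19:10Z); SKELETON rows **B7.Prop4 / B7.Eq127** (display (136); owner r04),
**B9.Eq3.127** and **B9.Eq3.134** (the `h149` input of `B9Delta2Def134.ineq3137b_of_149`; owner r06), **B11.Eq55** ((56); the hypotheses
`C2`/`hsym`/`c₂` of `B11Eq56Expansion`; owner r08).  THE PRINT.  [B7] p. 39: *«The function C_k can be decomposed further into a sum of
homogeneous polynomials, C_k(U₀, A) = C_k^{(2)}(U₀, A) + C_k^{(3)}(U₀, A) + … . (136)»*; p. 40: *«We will prove by induction that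
|⟨(δ/δA)C_j(U₀, A), δA⟩| ≦ C₃|A|Q″_j|δA|, (149) where the configurations A are considered on L^{−j}-lattice»*; p. 39 (137)–(138): *«dF(A, δA) =
(d/dt)F(A + tδA)|_{t=0}»*, *«(Q″A)_c = Σ_{b⊂B(c₋)∪B(c₊)} L^{−d}A_b (140)»*.  [B9] p. 421: *«The function C^{(2)}(A) is defined at bonds of 𝔅,
and on Λ_j it coincides with C_j^{(2)}(LʲηA) — a second order term in the expansion of Q_j(ηA)»*; p. 422: *«The inequality (149) in [5]
implies |⟨δA, Δ^{(2)}A⟩| ≦ O(1)C₃Mα₀ Σ_{j=0}^{k} Σ_{b∈Λ_j} (Lʲη)^{d−2}(Q″_j|δA|)(c)|A|_c»* — i.e. (149) is USED FOR THE SECOND-ORDER TERM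
`C_j^{(2)}`.  [B11] p. 286 (56): *«where C_j^{(n)}, D^{(n)} are homogeneous polynomials of n-th order. … Here C_j^{(2)}(A′, A″) denotes a
symmetric bilinear form obtained by polarization from the quadratic form C^{(2)}(A′), and C^{(2)}(A′) = C_j^{(2)}(LʲηA′) on Λ_j.»*
The step «(149) holds for C_j^{(2)}» is printed nowhere (it is the one-line homogeneity argument below); this file is our formalisation
of the printed USE.

DICTIONARY (as in `B7Prop5GeneralInduction` / `B7Ineq149Pairing`; every level rescaled to `ℤᵈ`).  `C_j(U₀, B)(c)` ↦ `CCovIter L U₀ B j z κ`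
(`c = (z, κ)`; `= logCovIter − linCovIter`, [B7] (150)); THIS FILE: **`C_j^{(2)}(U₀, B)(c)` ↦ `CCovIter2 L U₀ B j z κ := ½·(d²/dt²) C_j(U₀,
t·B)(c)|_{t=0}`** (`t ∈ ℂ`; the `t²`-coefficient of the slice, (137)); the finitely many variables `B_s, s ∈ S` ↦ `a : S → 𝔸` inserted by
`B7Prop3Flat.insCfg S a`; the polarization `C_j^{(2)}(A′, A″)` ↦ `½·D²[C_j(U₀, ins_S ·)(c)](0)(a′)(a″)` (`fderiv ℂ (fderiv ℂ …) 0`);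
`C₃|A|Q″_j|δA|(c)` ↦ `C3Gen d L·(Lʲ)²·‖a‖·Σ_{s∈S} kerQdd L j z κ s·‖δa_s‖` (print's `|A| = Lʲ‖a‖`, `δA_s = Lʲδa_s`, (141) `kerQdd =
L^{−jd}𝟙[s ⊂ Bʲ(c₋) ∪ Bʲ(c₊)]`, exactly as in `B7Ineq149Pairing`).  Regime = that of `B7Ineq149Pairing` (`L ≥ 2`, structure group
`AvgClosed`, (52) `pdev U₀ < α₀L^{−2k}`, `C₀α₀ ≤ ⅓`, `4α₀ ≤ c₂′`, (145)/(155) smallness `h145`/`h155`) at SOME witness radius `b > 0`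
(`hsmall`, `hc₃`, `h155` mention `Lᵏb`); the conclusions about `C_j^{(2)}` hold at EVERY `a ∈ 𝔸^S` (homogeneity).

WHAT THIS FILE PROVES (kernel, 0 sorry, standard axioms; one definition with body, theorems).
* §0 (private, [folklore]) the slice calculus along complex lines `t ↦ t·a`: `(d/dt)Df(ta)δa|₀ = D²f(0)(a)(δa)`, the limit argument
  `‖D²f(0)(a)(δa)‖ ≤ K` from `‖Df(ra)δa‖ ≤ Kr` (`r → 0⁺`), `(d²/dt²)f(ta)|₀ = D²f(0)(a)(a)`, `D[½B(v,v)](a) = B(a,·)` for symmetric `B`.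
* §1 `CCovIter2` (the definition above), `CCovIter2_zero_field`.
* §2 on `𝔸^S`, `j ≤ k`, writing `f(a) = C_j(U₀, ins_S a)(c)` and `D²f(0) = fderiv ℂ (fderiv ℂ f) 0`:
  `analyticAt_CCovIter_ins` (on the closed polydisc of radius `b`), `CCovIter_ins_zero`/`fderiv_CCovIter_ins_zero` (`f(0) = 0`, `Df(0) = 0`,
  r04's `B7Prop4GeneralCk.prop4_general_Ck_ins` at the level `j`), `hasFDerivAt_fderiv_CCovIter_ins_zero`;
  **`norm_snd_fderiv_CCovIter_ins_le`** — THE KEY: `‖D²f(0)(a)(δa)‖ ≤ C₃(Lʲ)²‖a‖·Σ_s kerQdd(c,s)‖δa_s‖` for ALL `a, δa` (proof: `g(t) =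
  Df(ta)δa` has `g(0) = 0`, `g′(0) = D²f(0)(a)(δa)`, and `‖g(t)‖ ≤ C₃(Lʲ)²(t‖a‖)Σ…` by (149) = `B7Ineq149Pairing.ineq149_pairing` at the
  radius `t‖a‖ → 0`); `snd_fderiv_CCovIter_ins_symm` (the polarization is SYMMETRIC — [B11] (56));
  **`CCovIter2_ins_eq`**: `C_j^{(2)}(U₀, ins_S a)(c) = ½·D²f(0)(a)(a)` (the slice definition IS the diagonal of the polarization);
  **`hasFDerivAt_CCovIter2_ins`**: `D[C_j^{(2)}(U₀, ins_S ·)(c)](a) = D²f(0)(a)` («obtained by polarization»);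
  **`ineq149_secondOrder`**: `‖D[C_j^{(2)}(U₀, ins_S ·)(c)](a)δa‖ ≤ C₃(Lʲ)²‖a‖·Σ_s kerQdd(c,s)‖δa_s‖` — (149) FOR `C_j^{(2)}`, at every `a`;
  `ineq149_secondOrder_of_le` (the `|A| ≤ Lʲb′` form), `opNorm_fderiv_CCovIter2_ins_le` (`≤ 2dC₃(Lʲ)²‖a‖`);
  `norm_CCovIter2_ins_le` (`‖C_j^{(2)}‖ ≤ ½C₃(Lʲ)²‖a‖Σ_s kerQdd‖a_s‖ ≤ dC₃(Lʲ)²‖a‖²`), `CCovIter2_ins_smul` (2-homogeneity).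
NOT CLAIMED here: the higher terms `C^{(n)}`, `n ≥ 3`, of (136) and the convergence of (136) (r04 `B7Prop4GeneralCk.prop4_general_Ck_powerSeries`
has the series with `p₀ = p₁ = 0`); the [B9] display itself ((3.136)-bookkeeping over the multiscale set `𝔅`) — sequel file; locality of
`C_j^{(2)}(U₀, B)(c)` in `B` for fields not of the form `ins_S a`.
-/

noncomputable section

open scoped BigOperators Topology
open NormedSpace Finset Metric Filter

namespace Literature.MathematicalPhysics.QuantumFieldTheory.Balaban1983to89.B7Eq136SecondOrder

open B7Prop1Explicit B7Prop1Local B7Prop2Explicit B7Prop3Flat B7Prop4Flat B7Eq92Concrete B7Prop3GeneralLinear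
  B7Prop4GeneralLevels B7Ineq148 B7Prop5GeneralOperators B7Prop5GeneralLinear B7Prop5GeneralInduction B7Prop5GeneralLevels
  B7Prop5General B7Ineq149Pairing
open B7Prop5Flat (BondIn bump)
open B7Prop5FlatOperator (insCfg_line norm_insCfg_le_of_le)
open B7Prop6GeneralAnalytic (prop4_general_analyticAt)
open B7Prop4GeneralCk (clm_linCovIter_ins prop4_general_Ck_ins)

-- `Site` alone would resolve to the torus sites of `Setup.lean`; re-export the `ℤ^d` sites of `B7Prop1Explicit`.
export B7Prop1Explicit (Site)

variable {d : ℕ}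

/-! ## §0 Slice calculus (generic, private): second derivatives along complex lines -/

section SliceCalculus

variable {E F : Type*} [NormedAddCommGroup E] [NormedSpace ℂ E] [NormedAddCommGroup F] [NormedSpace ℂ F]

/-- positive reals, read in `ℂ`, tend to `0` within `ℂ ∖ {0}`. [folklore] -/
private theorem tendsto_ofReal_nhdsGT : Tendsto (fun r : ℝ => (r : ℂ)) (𝓝[>] (0 : ℝ)) (𝓝[≠] (0 : ℂ)) := by
  have h : ContinuousWithinAt (fun r : ℝ => (r : ℂ)) (Set.Ioi 0) 0 := Complex.continuous_ofReal.continuousWithinAt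
  have h2 := h.tendsto_nhdsWithin (t := {(0 : ℂ)}ᶜ) fun r hr => by
    simpa using (ne_of_gt (Set.mem_Ioi.mp hr))
  simpa using h2

/-- the slice of a first derivative: `(d/dt) Df(t·a)(δa)|_{t=0} = D²f(0)(a)(δa)` ([B7] (137) applied to `Df(·)δa`). [folklore] -/
private theorem hasDerivAt_fderiv_slice {f : E → F} {D2 : E →L[ℂ] E →L[ℂ] F} (hF2 : HasFDerivAt (fderiv ℂ f) D2 0)
    (a δa : E) : HasDerivAt (fun t : ℂ => fderiv ℂ f (t • a) δa) (D2 a δa) 0 := by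
  have h1 : HasDerivAt (fun t : ℂ => t • a) a 0 := by simpa using (hasDerivAt_id (0 : ℂ)).smul_const a
  have hφ : HasFDerivAt (fun v : E => fderiv ℂ f v δa) ((ContinuousLinearMap.apply ℂ F δa).comp D2) ((0 : ℂ) • a) := by
    rw [zero_smul]
    exact (ContinuousLinearMap.apply ℂ F δa).hasFDerivAt.comp (0 : E) hF2
  have h2 : HasDerivAt ((fun v : E => fderiv ℂ f v δa) ∘ fun t : ℂ => t • a)
      (((ContinuousLinearMap.apply ℂ F δa).comp D2) a) 0 := hφ.comp_hasDerivAt (0 : ℂ) h1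
  simpa [Function.comp_def] using h2

/-- **the limit argument**: if `Df(0) = 0`, `Df` is differentiable at `0` with derivative `D²f(0)`, and along the real ray
`‖Df(r·a)(δa)‖ ≤ K·r` for `0 < r ≤ r₀`, then `‖D²f(0)(a)(δa)‖ ≤ K` (`D²f(0)(a)(δa) = lim_{r→0⁺} r⁻¹Df(r·a)(δa)`). [folklore] -/
private theorem norm_snd_le_of_slice_bound {f : E → F} {D2 : E →L[ℂ] E →L[ℂ] F} (hF2 : HasFDerivAt (fderiv ℂ f) D2 0)
    (h0 : fderiv ℂ f 0 = 0) {a δa : E} {K r₀ : ℝ} (hr₀ : 0 < r₀)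
    (hbd : ∀ r : ℝ, 0 < r → r ≤ r₀ → ‖fderiv ℂ f ((r : ℂ) • a) δa‖ ≤ K * r) : ‖D2 a δa‖ ≤ K := by
  have hg := hasDerivAt_fderiv_slice hF2 a δa
  have hg0 : fderiv ℂ f ((0 : ℂ) • a) δa = 0 := by rw [zero_smul, h0, zero_apply]
  have hlim : Tendsto (fun t : ℂ => t⁻¹ • fderiv ℂ f (t • a) δa) (𝓝[≠] (0 : ℂ)) (𝓝 (D2 a δa)) := by
    have h := hg.tendsto_slope_zero
    simp only [zero_add] at h
    refine h.congr' (Eventually.of_forall fun t => ?_)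
    rw [hg0, sub_zero]
  have hlimR := (hlim.comp tendsto_ofReal_nhdsGT).norm
  have hbound : ∀ᶠ r : ℝ in 𝓝[>] 0, ‖((fun t : ℂ => t⁻¹ • fderiv ℂ f (t • a) δa) ∘ fun r : ℝ => (r : ℂ)) r‖ ≤ K := by
    filter_upwards [Ioc_mem_nhdsGT hr₀] with r hr
    obtain ⟨hr0, hrr⟩ := hr
    rw [Function.comp_apply, norm_smul, norm_inv, Complex.norm_real, Real.norm_of_nonneg hr0.le]
    calc r⁻¹ * ‖fderiv ℂ f ((r : ℂ) • a) δa‖ ≤ r⁻¹ * (K * r) :=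
          mul_le_mul_of_nonneg_left (hbd r hr0 hrr) (inv_nonneg.mpr hr0.le)
      _ = K := by field_simp
  exact le_of_tendsto hlimR hbound

/-- the second `t`-derivative of the slice `t ↦ f(t·a)` at `0` is `D²f(0)(a)(a)` (for `f` differentiable near `0`). [folklore] -/
private theorem iteratedDeriv_two_slice {f : E → F} {D2 : E →L[ℂ] E →L[ℂ] F} (hf : ∀ᶠ v in 𝓝 (0 : E), DifferentiableAt ℂ f v)
    (hF2 : HasFDerivAt (fderiv ℂ f) D2 0) (a : E) : iteratedDeriv 2 (fun t : ℂ => f (t • a)) 0 = D2 a a := by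
  rw [iteratedDeriv_succ, iteratedDeriv_one]
  have hline : Tendsto (fun t : ℂ => t • a) (𝓝 0) (𝓝 (0 : E)) := by
    have hc : Continuous (fun t : ℂ => t • a) := continuous_id.smul continuous_const
    simpa using hc.tendsto 0
  have hev : ∀ᶠ t : ℂ in 𝓝 0, DifferentiableAt ℂ f (t • a) := hline.eventually hf
  have hderiv : deriv (fun t : ℂ => f (t • a)) =ᶠ[𝓝 (0 : ℂ)] fun t : ℂ => fderiv ℂ f (t • a) a := by
    filter_upwards [hev] with t ht
    have h1 : HasDerivAt (fun s : ℂ => s • a) a t := by simpa using (hasDerivAt_id t).smul_const a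
    have h2 : HasDerivAt (f ∘ fun s : ℂ => s • a) (fderiv ℂ f (t • a) a) t := ht.hasFDerivAt.comp_hasDerivAt t h1
    exact h2.deriv
  rw [hderiv.deriv_eq]
  exact (hasDerivAt_fderiv_slice hF2 a a).deriv

/-- the derivative of the quadratic form of a SYMMETRIC continuous bilinear map: `D[v ↦ ½B(v,v)](a) = B(a, ·)`. [folklore] -/
private theorem hasFDerivAt_half_quadratic {D2 : E →L[ℂ] E →L[ℂ] F} (hsymm : ∀ v w, D2 v w = D2 w v) (a : E) :
    HasFDerivAt (fun v : E => (2 : ℂ)⁻¹ • D2 v v) (D2 a) a := by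
  have hq : HasFDerivAt (fun v : E => D2 v v)
      (D2.precompR E a (ContinuousLinearMap.id ℂ E) + D2.precompL E (ContinuousLinearMap.id ℂ E) a) a :=
    D2.hasFDerivAt_of_bilinear (hasFDerivAt_id a) (hasFDerivAt_id a)
  refine (hq.const_smul (2 : ℂ)⁻¹).congr_fderiv ?_
  ext w
  simp only [smul_apply, add_apply, ContinuousLinearMap.precompR_apply, ContinuousLinearMap.precompL_apply,
    ContinuousLinearMap.compL_apply, ContinuousLinearMap.coe_comp, Function.comp_apply, ContinuousLinearMap.coe_id',
    id_eq, hsymm w a, smul_add]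
  rw [← add_smul]
  norm_num

end SliceCalculus

/-! ## §1 The second-order term `C_j⁽²⁾(U₀, B)(c)` -/

section Def

variable {𝔸 : Type*} [NormedRing 𝔸] [NormedAlgebra ℂ 𝔸] [CompleteSpace 𝔸]

/-- **`C_j⁽²⁾(U₀, B)(c)`, THE SECOND-ORDER TERM of the remainder `C_j(U₀, ·)(c)`** — [B7] (136) «C_k(U₀, A) = C_k^{(2)}(U₀, A) +
C_k^{(3)}(U₀, A) + …» (homogeneous polynomials), [B9] p. 421 «C_j^{(2)}(LʲηA) — a second order term in the expansion of Q_j(ηA)»: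
the `t²`-coefficient `½·(d²/dt²)C_j(U₀, t·B)(c)|_{t=0}` of the complex slice `t ↦ C_j(U₀, tB)(c)` (the series' own slice calculus,
[B7] (137)). [cite: Balaban1985Averaging, (136) p.39, (137) p.39]
[cite: Balaban1985BackgroundPropagators, (3.127) p.421] -/
def CCovIter2 (L : ℕ) (U₀ : Site d → Fin d → 𝔸ˣ) (B : Site d → Fin d → 𝔸) (j : ℕ) (z : Site d) (κ : Fin d) : 𝔸 :=
  (2 : ℂ)⁻¹ • iteratedDeriv 2 (fun t : ℂ => CCovIter L U₀ (t • B) j z κ) 0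

/-- `CCovIter2` unfolded. [cite: Balaban1985Averaging, (136) p.39] -/
theorem CCovIter2_def (L : ℕ) (U₀ : Site d → Fin d → 𝔸ˣ) (B : Site d → Fin d → 𝔸) (j : ℕ) (z : Site d) (κ : Fin d) :
    CCovIter2 L U₀ B j z κ = (2 : ℂ)⁻¹ • iteratedDeriv 2 (fun t : ℂ => CCovIter L U₀ (t • B) j z κ) 0 := rfl

/-- `C_j⁽²⁾(U₀, 0) = 0` (the slice through `0` is constant). [cite: Balaban1985Averaging, (136) p.39] -/
theorem CCovIter2_zero_field (L : ℕ) (U₀ : Site d → Fin d → 𝔸ˣ) (j : ℕ) (z : Site d) (κ : Fin d) :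
    CCovIter2 L U₀ (0 : Site d → Fin d → 𝔸) j z κ = 0 := by
  simp [CCovIter2, smul_zero, iteratedDeriv_const]

end Def

/-! ## §2 On the variable space `𝔸^S`: polarization and (149) for `C_j⁽²⁾` -/

section Regime

variable {𝔸 : Type*} [NormedRing 𝔸] [NormedAlgebra ℂ 𝔸] [CompleteSpace 𝔸] [NormOneClass 𝔸]

/-- `C₃ ≥ 0`. [folklore] -/
private theorem C3Gen_nonneg' (d L : ℕ) : 0 ≤ C3Gen d L := by
  unfold C3Gen C1ppGen; positivity

/-- the smallness hypotheses of the regime are monotone in the radius (private arithmetic). [folklore] -/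
private theorem regime_mono {L k d : ℕ} {α₀ b b' : ℝ} (hbb : b' ≤ b)
    (hsmall : Real.exp (4 * (800 * ((d : ℝ) + 1) ^ 2 * ((d : ℝ) + 4)) * α₀)
      * (1 + 8 * (131072 * ((d : ℝ) + 1) ^ 2) * ((L : ℝ) ^ k * b)) ≤ 2)
    (hc₃ : 4 * ((L : ℝ) ^ k * b) < c3 d L)
    (h155 : (2 * (L : ℝ) - 1) * (L : ℝ)⁻¹ ^ 2 + 2 * d * thetaGen d L α₀ * (L : ℝ)⁻¹ ^ 3
      + 1 / 8 * (1 + 2 * d * thetaGen d L α₀ * (L : ℝ)⁻¹ ^ 2 + 2 * d * C3Gen d L * ((L : ℝ) ^ k * b)) * (L : ℝ)⁻¹ ^ 2 ≤ 1) :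
    Real.exp (4 * (800 * ((d : ℝ) + 1) ^ 2 * ((d : ℝ) + 4)) * α₀)
        * (1 + 8 * (131072 * ((d : ℝ) + 1) ^ 2) * ((L : ℝ) ^ k * b')) ≤ 2 ∧
      4 * ((L : ℝ) ^ k * b') < c3 d L ∧
      (2 * (L : ℝ) - 1) * (L : ℝ)⁻¹ ^ 2 + 2 * d * thetaGen d L α₀ * (L : ℝ)⁻¹ ^ 3
        + 1 / 8 * (1 + 2 * d * thetaGen d L α₀ * (L : ℝ)⁻¹ ^ 2 + 2 * d * C3Gen d L * ((L : ℝ) ^ k * b')) * (L : ℝ)⁻¹ ^ 2 ≤ 1 := by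
  have hLk : (0 : ℝ) ≤ (L : ℝ) ^ k := by positivity
  have hm : (L : ℝ) ^ k * b' ≤ (L : ℝ) ^ k * b := mul_le_mul_of_nonneg_left hbb hLk
  have hC := C3Gen_nonneg' d L
  refine ⟨?_, by linarith, ?_⟩
  · have hexp : 0 ≤ Real.exp (4 * (800 * ((d : ℝ) + 1) ^ 2 * ((d : ℝ) + 4)) * α₀) := (Real.exp_pos _).le
    have h1 : 1 + 8 * (131072 * ((d : ℝ) + 1) ^ 2) * ((L : ℝ) ^ k * b')
        ≤ 1 + 8 * (131072 * ((d : ℝ) + 1) ^ 2) * ((L : ℝ) ^ k * b) := by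
      have : 0 ≤ 8 * (131072 * ((d : ℝ) + 1) ^ 2) := by positivity
      nlinarith
    exact (mul_le_mul_of_nonneg_left h1 hexp).trans hsmall
  · have h1 : 2 * (d : ℝ) * C3Gen d L * ((L : ℝ) ^ k * b') ≤ 2 * d * C3Gen d L * ((L : ℝ) ^ k * b) :=
      mul_le_mul_of_nonneg_left hm (by positivity)
    have h2 : 0 ≤ 1 / 8 * (L : ℝ)⁻¹ ^ 2 := by positivity
    nlinarith

variable (L : ℕ) (hL : 2 ≤ L) {G : Subgroup 𝔸ˣ} (hG : AvgClosed d L G) (k : ℕ)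
  (U₀ : Site d → Fin d → 𝔸ˣ) (hU₀ : ∀ x κ, U₀ x κ ∈ G) {α₀ : ℝ} (hα : 0 < α₀)
  (hα3 : C0 d * α₀ ≤ 1 / 3) (hα4 : 4 * α₀ ≤ c2' d L) (h52 : pdev U₀ < α₀ * (((L : ℝ) ^ k)⁻¹) ^ 2)
  {b : ℝ} (hb : 0 < b)
  (hsmall : Real.exp (4 * (800 * ((d : ℝ) + 1) ^ 2 * ((d : ℝ) + 4)) * α₀)
    * (1 + 8 * (131072 * ((d : ℝ) + 1) ^ 2) * ((L : ℝ) ^ k * b)) ≤ 2)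
  (hc₃ : 4 * ((L : ℝ) ^ k * b) < c3 d L)
  (h145 : 8 * d * thetaGen d L α₀ * (L : ℝ)⁻¹ ^ 4 ≤ 1)
  (h155 : (2 * (L : ℝ) - 1) * (L : ℝ)⁻¹ ^ 2 + 2 * d * thetaGen d L α₀ * (L : ℝ)⁻¹ ^ 3
    + 1 / 8 * (1 + 2 * d * thetaGen d L α₀ * (L : ℝ)⁻¹ ^ 2 + 2 * d * C3Gen d L * ((L : ℝ) ^ k * b)) * (L : ℝ)⁻¹ ^ 2 ≤ 1)
  (S : Finset (Site d × Fin d))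

omit [NormedAlgebra ℂ 𝔸] [CompleteSpace 𝔸] [NormOneClass 𝔸] in
include hL hα h52 hb hsmall hc₃ in
/-- the regime at the level `j ≤ k` in the form r04's level-`j` theorems take it: (52) at the level `j`, and Prop. 4's smallness
with `Lʲb ≤ Lᵏb`. [cite: Balaban1985Averaging, p.37 (after (127)), (52) p.26] -/
private theorem regime_level {j : ℕ} (hj : j ≤ k) :
    pdev U₀ < α₀ * (((L : ℝ) ^ j)⁻¹) ^ 2 ∧
      Real.exp (4 * (800 * ((d : ℝ) + 1) ^ 2 * ((d : ℝ) + 4)) * α₀)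
          * (1 + 8 * (131072 * ((d : ℝ) + 1) ^ 2) * ((L : ℝ) ^ j * b)) ≤ 2 ∧
      2 * ((L : ℝ) ^ j * b) ≤ c3 d L := by
  have hL1r : (1 : ℝ) ≤ L := by exact_mod_cast le_trans (by norm_num) hL
  have hLj : (0 : ℝ) < (L : ℝ) ^ j := by positivity
  have hLk : (0 : ℝ) < (L : ℝ) ^ k := by positivity
  have hjk : (L : ℝ) ^ j ≤ (L : ℝ) ^ k := pow_le_pow_right₀ hL1r hj
  have hinv : ((L : ℝ) ^ k)⁻¹ ≤ ((L : ℝ) ^ j)⁻¹ := by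
    rw [inv_le_inv₀ hLk hLj]; exact hjk
  have h1 : α₀ * (((L : ℝ) ^ k)⁻¹) ^ 2 ≤ α₀ * (((L : ℝ) ^ j)⁻¹) ^ 2 :=
    mul_le_mul_of_nonneg_left (pow_le_pow_left₀ (by positivity) hinv 2) hα.le
  have hjb : (L : ℝ) ^ j * b ≤ (L : ℝ) ^ k * b := mul_le_mul_of_nonneg_right hjk hb.le
  have hLkb : 0 ≤ (L : ℝ) ^ k * b := by positivity
  have h2 : Real.exp (4 * (800 * ((d : ℝ) + 1) ^ 2 * ((d : ℝ) + 4)) * α₀)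
        * (1 + 8 * (131072 * ((d : ℝ) + 1) ^ 2) * ((L : ℝ) ^ j * b))
      ≤ Real.exp (4 * (800 * ((d : ℝ) + 1) ^ 2 * ((d : ℝ) + 4)) * α₀)
        * (1 + 8 * (131072 * ((d : ℝ) + 1) ^ 2) * ((L : ℝ) ^ k * b)) :=
    mul_le_mul_of_nonneg_left (by nlinarith) (Real.exp_pos _).le
  exact ⟨h52.trans_le h1, h2.trans hsmall, by linarith⟩

include hL hG hU₀ hα hα3 hα4 h52 hb hsmall hc₃ in
/-- **`a ↦ C_j(U₀, ins_S a)(c)` IS ANALYTIC** at every point of the closed polydisc `‖a_s‖ ≤ b`, `j ≤ k`: `Q_j(U₀, ins_S ·)(c)` is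
analytic there (Prop. 4 at a general background, `B7Prop6GeneralAnalytic.prop4_general_analyticAt`) and `LʲηQ_j(U₀)(ins_S ·)(c)` is a
continuous linear form (`B7Prop4GeneralCk.clm_linCovIter_ins`). [cite: Balaban1985Averaging, Prop. 4 p.38, (134) p.38, (136) p.39] -/
theorem analyticAt_CCovIter_ins {j : ℕ} (hj : j ≤ k) (z : Site d) (κ : Fin d) {a : S → 𝔸} (ha : ∀ s, ‖a s‖ ≤ b) :
    AnalyticAt ℂ (fun a' : S → 𝔸 => CCovIter L U₀ (insCfg S a') j z κ) a := by
  have hLkb : 0 ≤ (L : ℝ) ^ k * b := by positivity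
  have hc₃' : 2 * ((L : ℝ) ^ k * b) ≤ c3 d L := by linarith
  have hlog : AnalyticAt ℂ (fun a' : S → 𝔸 => logCovIter L U₀ (insCfg S a') j z κ) a :=
    prop4_general_analyticAt L hL hG k U₀ hU₀ hα hα3 hα4 h52 (fun a' : S → 𝔸 => insCfg S a')
      (fun x κ' => analyticAt_insCfg S x κ' a) hb.le (fun x κ' => norm_insCfg_le_of_le hb.le ha x κ') hsmall hc₃' j hj z κ
  obtain ⟨h52j, hsmallj, hc3j⟩ := regime_level L hL k U₀ hα h52 hb hsmall hc₃ hj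
  obtain ⟨Λ, hΛ⟩ := clm_linCovIter_ins S L hL hG j U₀ hU₀ hα hα3 hα4 h52j hb hsmallj hc3j z κ
  have hlin : AnalyticAt ℂ (fun a' : S → 𝔸 => linCovIter L U₀ (insCfg S a') j z κ) a := by
    have : (fun a' : S → 𝔸 => linCovIter L U₀ (insCfg S a') j z κ) = fun a' => Λ a' := funext fun a' => (hΛ a').symm
    rw [this]; exact Λ.analyticAt a
  exact hlog.sub hlin

include hL hG hU₀ hα hα3 hα4 h52 hb hsmall hc₃ in
/-- **`C_j(U₀, 0)(c) = 0` AND `D[C_j(U₀, ins_S ·)(c)](0) = 0`** — (136) has no terms of order `0` and `1` (r04's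
`B7Prop4GeneralCk.prop4_general_Ck_ins`, taken at the level `j ≤ k`). [cite: Balaban1985Averaging, (134)–(135) p.38, (136) p.39] -/
theorem CCovIter_ins_zero_and_fderiv_zero {j : ℕ} (hj : j ≤ k) (z : Site d) (κ : Fin d) :
    CCovIter L U₀ (insCfg S (0 : S → 𝔸)) j z κ = 0 ∧
      HasFDerivAt (fun a' : S → 𝔸 => CCovIter L U₀ (insCfg S a') j z κ) (0 : (S → 𝔸) →L[ℂ] 𝔸) 0 := by
  obtain ⟨h52j, hsmallj, hc3j⟩ := regime_level L hL k U₀ hα h52 hb hsmall hc₃ hj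
  obtain ⟨-, h0, hD⟩ := prop4_general_Ck_ins S L hL hG j U₀ hU₀ hα hα3 hα4 h52j hb hsmallj hc3j z κ
  exact ⟨h0, hD⟩

include hL hG hU₀ hα hα3 hα4 h52 hb hsmall hc₃ in
/-- `C_j(U₀, ins_S 0)(c) = 0`. [cite: Balaban1985Averaging, (134)–(136) pp.38–39] -/
theorem CCovIter_ins_zero {j : ℕ} (hj : j ≤ k) (z : Site d) (κ : Fin d) :
    CCovIter L U₀ (insCfg S (0 : S → 𝔸)) j z κ = 0 :=
  (CCovIter_ins_zero_and_fderiv_zero L hL hG k U₀ hU₀ hα hα3 hα4 h52 hb hsmall hc₃ S hj z κ).1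

include hL hG hU₀ hα hα3 hα4 h52 hb hsmall hc₃ in
/-- `D[C_j(U₀, ins_S ·)(c)](0) = 0` (the Fréchet derivative at the origin vanishes). [cite: Balaban1985Averaging, (134)–(136) pp.38–39] -/
theorem fderiv_CCovIter_ins_zero {j : ℕ} (hj : j ≤ k) (z : Site d) (κ : Fin d) :
    fderiv ℂ (fun a' : S → 𝔸 => CCovIter L U₀ (insCfg S a') j z κ) 0 = 0 :=
  (CCovIter_ins_zero_and_fderiv_zero L hL hG k U₀ hU₀ hα hα3 hα4 h52 hb hsmall hc₃ S hj z κ).2.fderiv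

include hL hG hU₀ hα hα3 hα4 h52 hb hsmall hc₃ in
/-- **the polarization exists**: `a ↦ D[C_j(U₀, ins_S ·)(c)](a)` is Fréchet-differentiable at `0` with derivative the continuous bilinear
map `D²[C_j(U₀, ins_S ·)(c)](0) = fderiv ℂ (fderiv ℂ …) 0` (analyticity). [cite: Balaban1985Averaging, (136) p.39]
[cite: Balaban1985Variational, (56) p.286] -/
theorem hasFDerivAt_fderiv_CCovIter_ins_zero {j : ℕ} (hj : j ≤ k) (z : Site d) (κ : Fin d) :
    HasFDerivAt (fderiv ℂ (fun a' : S → 𝔸 => CCovIter L U₀ (insCfg S a') j z κ))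
      (fderiv ℂ (fderiv ℂ (fun a' : S → 𝔸 => CCovIter L U₀ (insCfg S a') j z κ)) 0) 0 := by
  have han : AnalyticAt ℂ (fun a' : S → 𝔸 => CCovIter L U₀ (insCfg S a') j z κ) 0 :=
    analyticAt_CCovIter_ins L hL hG k U₀ hU₀ hα hα3 hα4 h52 hb hsmall hc₃ S hj z κ (fun s => by simpa using hb.le)
  exact han.fderiv.differentiableAt.hasFDerivAt

include hL hG hU₀ hα hα3 hα4 h52 hb hsmall hc₃ in
/-- the slice derivative: `(d/dt) D[C_j(U₀, ins_S ·)(c)](t·a)(δa)|_{t=0} = D²[…](0)(a)(δa)` (chain rule through the polarization).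
[cite: Balaban1985Averaging, (137) p.39] -/
theorem hasDerivAt_fderiv_CCovIter_ins_slice {j : ℕ} (hj : j ≤ k) (z : Site d) (κ : Fin d) (a δa : S → 𝔸) :
    HasDerivAt (fun t : ℂ => fderiv ℂ (fun a' : S → 𝔸 => CCovIter L U₀ (insCfg S a') j z κ) (t • a) δa)
      (fderiv ℂ (fderiv ℂ (fun a' : S → 𝔸 => CCovIter L U₀ (insCfg S a') j z κ)) 0 a δa) 0 :=
  hasDerivAt_fderiv_slice (hasFDerivAt_fderiv_CCovIter_ins_zero L hL hG k U₀ hU₀ hα hα3 hα4 h52 hb hsmall hc₃ S hj z κ) a δa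

include hL hG hU₀ hα hα3 hα4 h52 hb hsmall hc₃ h145 h155 in
/-- **THE KEY ESTIMATE — the polarization of `C_j⁽²⁾` inherits (149)**: for ALL `a, δa ∈ 𝔸^S`,
`‖D²[C_j(U₀, ins_S ·)(c)](0)(a)(δa)‖ ≤ C₃·(Lʲ)²·‖a‖·Σ_{s∈S} kerQdd(c, s)·‖δa_s‖` («C₃|A|Q″_j|δA|» with `|A| = Lʲ‖a‖`).  Proof: with
`f = C_j(U₀, ins_S ·)(c)` and `g(t) = Df(t·a)(δa)`, `g(0) = 0` (`Df(0) = 0`), `g′(0) = D²f(0)(a)(δa)`, and for small real `t > 0`, (149)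
(`B7Ineq149Pairing.ineq149_pairing` at the radius `t‖a‖`) gives `‖g(t)‖ ≤ C₃(Lʲ)²(t‖a‖)Σ…`; divide by `t` and let `t → 0`.
[cite: Balaban1985Averaging, (149) p.40, (136)–(137) p.39] [cite: Balaban1985BackgroundPropagators, (3.136)–(3.137) p.422] -/
theorem norm_snd_fderiv_CCovIter_ins_le {j : ℕ} (hj : j ≤ k) (z : Site d) (κ : Fin d) (a δa : S → 𝔸) :
    ‖fderiv ℂ (fderiv ℂ (fun a' : S → 𝔸 => CCovIter L U₀ (insCfg S a') j z κ)) 0 a δa‖ ≤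
      C3Gen d L * ((L : ℝ) ^ j) ^ 2 * ‖a‖ * ∑ s : S, kerQdd L j z κ s.1.1 s.1.2 * ‖δa s‖ := by
  set Q : ℝ := ∑ s : S, kerQdd L j z κ s.1.1 s.1.2 * ‖δa s‖ with hQ
  have hQ0 : 0 ≤ Q := sum_nonneg fun s _ => mul_nonneg (kerQdd_nonneg L j z κ _ _) (norm_nonneg _)
  have hC := C3Gen_nonneg' d L
  by_cases ha0 : a = 0
  · subst ha0
    simp only [map_zero, zero_apply, norm_zero, mul_zero, zero_mul]
    exact le_refl _
  have hapos : 0 < ‖a‖ := norm_pos_iff.mpr ha0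
  have hF2 := hasFDerivAt_fderiv_CCovIter_ins_zero L hL hG k U₀ hU₀ hα hα3 hα4 h52 hb hsmall hc₃ S hj z κ
  have hD0 := fderiv_CCovIter_ins_zero L hL hG k U₀ hU₀ hα hα3 hα4 h52 hb hsmall hc₃ S hj z κ
  -- (149) at the radius `r‖a‖ ≤ b` along the real ray, then the limit `r → 0⁺`
  refine norm_snd_le_of_slice_bound hF2 hD0 (K := C3Gen d L * ((L : ℝ) ^ j) ^ 2 * ‖a‖ * Q) (div_pos hb hapos)
    fun r hr0 hrb => ?_
  have hb'pos : 0 < r * ‖a‖ := mul_pos hr0 hapos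
  have hb'le : r * ‖a‖ ≤ b := (le_div_iff₀ hapos).1 hrb
  obtain ⟨hsmall', hc₃', h155'⟩ := regime_mono (L := L) (k := k) (d := d) (α₀ := α₀) hb'le hsmall hc₃ h155
  have ha' : ∀ s, ‖((r : ℂ) • a) s‖ ≤ r * ‖a‖ := fun s => by
    rw [Pi.smul_apply, norm_smul, Complex.norm_real, Real.norm_of_nonneg hr0.le]
    exact mul_le_mul_of_nonneg_left (norm_le_pi_norm a s) hr0.le
  obtain ⟨-, hbd⟩ := ineq149_pairing L hL hG k U₀ hU₀ hα hα3 hα4 h52 hb'pos hsmall' hc₃' h145 h155' S ha' hj z κ δa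
  refine hbd.trans (le_of_eq ?_)
  rw [← hQ]
  ring

include hL hG hU₀ hα hα3 hα4 h52 hb hsmall hc₃ in
/-- **THE POLARIZATION IS SYMMETRIC** — [B11] (56) «C_j^{(2)}(A′, A″) denotes a symmetric bilinear form obtained by polarization from the
quadratic form C^{(2)}(A′)»: `D²[C_j(U₀, ins_S ·)(c)](0)(v)(w) = D²[…](0)(w)(v)` (second derivatives of an analytic map commute).
[cite: Balaban1985Variational, (56) p.286] [cite: Balaban1985Averaging, (136) p.39] -/
theorem snd_fderiv_CCovIter_ins_symm {j : ℕ} (hj : j ≤ k) (z : Site d) (κ : Fin d) (v w : S → 𝔸) :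
    fderiv ℂ (fderiv ℂ (fun a' : S → 𝔸 => CCovIter L U₀ (insCfg S a') j z κ)) 0 v w =
      fderiv ℂ (fderiv ℂ (fun a' : S → 𝔸 => CCovIter L U₀ (insCfg S a') j z κ)) 0 w v := by
  have han : AnalyticAt ℂ (fun a' : S → 𝔸 => CCovIter L U₀ (insCfg S a') j z κ) 0 :=
    analyticAt_CCovIter_ins L hL hG k U₀ hU₀ hα hα3 hα4 h52 hb hsmall hc₃ S hj z κ (fun s => by simpa using hb.le)
  exact (han.contDiffAt (n := ⊤)).isSymmSndFDerivAt_of_omega v w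

include hL hG hU₀ hα hα3 hα4 h52 hb hsmall hc₃ in
/-- **THE SLICE DEFINITION IS THE DIAGONAL OF THE POLARIZATION**: `C_j⁽²⁾(U₀, ins_S a)(c) = ½·D²[C_j(U₀, ins_S ·)(c)](0)(a)(a)` — the
`t²`-coefficient of `t ↦ C_j(U₀, ins_S(ta))(c)` is half its second `t`-derivative at `0`, computed by the chain rule.
[cite: Balaban1985Averaging, (136)–(137) p.39] [cite: Balaban1985Variational, (56) p.286] -/
theorem CCovIter2_ins_eq {j : ℕ} (hj : j ≤ k) (z : Site d) (κ : Fin d) (a : S → 𝔸) :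
    CCovIter2 L U₀ (insCfg S a) j z κ =
      (2 : ℂ)⁻¹ • fderiv ℂ (fderiv ℂ (fun a' : S → 𝔸 => CCovIter L U₀ (insCfg S a') j z κ)) 0 a a := by
  rw [CCovIter2]
  congr 1
  -- the slice through `ins_S a` is `t ↦ C_j(U₀, ins_S(t·a))(c)`
  have hslice : (fun t : ℂ => CCovIter L U₀ (t • insCfg S a) j z κ) =
      fun t : ℂ => (fun a' : S → 𝔸 => CCovIter L U₀ (insCfg S a') j z κ) (t • a) := by
    funext t; simp only [insCfg_smul]
  rw [hslice]
  have han : AnalyticAt ℂ (fun a' : S → 𝔸 => CCovIter L U₀ (insCfg S a') j z κ) 0 :=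
    analyticAt_CCovIter_ins L hL hG k U₀ hU₀ hα hα3 hα4 h52 hb hsmall hc₃ S hj z κ (fun s => by simpa using hb.le)
  exact iteratedDeriv_two_slice (han.eventually_analyticAt.mono fun v hv => hv.differentiableAt)
    (hasFDerivAt_fderiv_CCovIter_ins_zero L hL hG k U₀ hU₀ hα hα3 hα4 h52 hb hsmall hc₃ S hj z κ) a

include hL hG hU₀ hα hα3 hα4 h52 hb hsmall hc₃ in
/-- **`C_j⁽²⁾(U₀, ins_S ·)(c)` IS THE QUADRATIC FORM OF ITS POLARIZATION AND `D[C_j⁽²⁾(U₀, ins_S ·)(c)](a) = D²[C_j](0)(a)`** — the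
functional derivative (137)–(138) of the second-order term is the (symmetric) polarization paired with `a`:
`⟨(δ/δA)C_j⁽²⁾(U₀, A), δA⟩ = 2·C_j⁽²⁾(A, δA)` in the normalisation `C⁽²⁾(A) = C⁽²⁾(A, A)` of [B11] (56).
[cite: Balaban1985Variational, (56) p.286] [cite: Balaban1985Averaging, (136)–(138) p.39] -/
theorem hasFDerivAt_CCovIter2_ins {j : ℕ} (hj : j ≤ k) (z : Site d) (κ : Fin d) (a : S → 𝔸) :
    HasFDerivAt (fun a' : S → 𝔸 => CCovIter2 L U₀ (insCfg S a') j z κ)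
      (fderiv ℂ (fderiv ℂ (fun a' : S → 𝔸 => CCovIter L U₀ (insCfg S a') j z κ)) 0 a) a := by
  have hfun : (fun a' : S → 𝔸 => CCovIter2 L U₀ (insCfg S a') j z κ) =
      fun a' => (2 : ℂ)⁻¹ • fderiv ℂ (fderiv ℂ (fun a' : S → 𝔸 => CCovIter L U₀ (insCfg S a') j z κ)) 0 a' a' :=
    funext fun a' => CCovIter2_ins_eq L hL hG k U₀ hU₀ hα hα3 hα4 h52 hb hsmall hc₃ S hj z κ a'
  rw [hfun]
  exact hasFDerivAt_half_quadratic
    (snd_fderiv_CCovIter_ins_symm L hL hG k U₀ hU₀ hα hα3 hα4 h52 hb hsmall hc₃ S hj z κ) a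

include hL hG hU₀ hα hα3 hα4 h52 hb hsmall hc₃ in
/-- `fderiv` form of `hasFDerivAt_CCovIter2_ins`. [cite: Balaban1985Variational, (56) p.286] [cite: Balaban1985Averaging, (136)–(138) p.39] -/
theorem fderiv_CCovIter2_ins {j : ℕ} (hj : j ≤ k) (z : Site d) (κ : Fin d) (a : S → 𝔸) :
    fderiv ℂ (fun a' : S → 𝔸 => CCovIter2 L U₀ (insCfg S a') j z κ) a =
      fderiv ℂ (fderiv ℂ (fun a' : S → 𝔸 => CCovIter L U₀ (insCfg S a') j z κ)) 0 a :=
  (hasFDerivAt_CCovIter2_ins L hL hG k U₀ hU₀ hα hα3 hα4 h52 hb hsmall hc₃ S hj z κ a).fderiv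

include hL hG hU₀ hα hα3 hα4 h52 hb hsmall hc₃ h145 h155 in
/-- **(149) FOR THE SECOND-ORDER TERM `C_j⁽²⁾`, AT EVERY `a ∈ 𝔸^S`** — the form in which [B9] p. 422 uses «the inequality (149) in [5]»
on `C_j⁽²⁾`: for every `j ≤ k`, every bond `c` of the `j`-th lattice, every `a` and every variation `δa`,
`‖⟨(δ/δA)C_j⁽²⁾(U₀, ins_S a), δa⟩(c)‖ ≤ C₃·(Lʲ)²·‖a‖·Σ_{s∈S} kerQdd(c, s)·‖δa_s‖` («C₃|A|Q″_j|δA|», `|A| = Lʲ‖a‖`); no smallness of `a` is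
needed (the polarization is bilinear). [cite: Balaban1985Averaging, (149) p.40, (136) p.39]
[cite: Balaban1985BackgroundPropagators, (3.136)–(3.137) p.422] -/
theorem ineq149_secondOrder {j : ℕ} (hj : j ≤ k) (z : Site d) (κ : Fin d) (a δa : S → 𝔸) :
    HasFDerivAt (fun a' : S → 𝔸 => CCovIter2 L U₀ (insCfg S a') j z κ)
        (fderiv ℂ (fun a' : S → 𝔸 => CCovIter2 L U₀ (insCfg S a') j z κ) a) a ∧
      ‖fderiv ℂ (fun a' : S → 𝔸 => CCovIter2 L U₀ (insCfg S a') j z κ) a δa‖ ≤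
        C3Gen d L * ((L : ℝ) ^ j) ^ 2 * ‖a‖ * ∑ s : S, kerQdd L j z κ s.1.1 s.1.2 * ‖δa s‖ := by
  have h := hasFDerivAt_CCovIter2_ins L hL hG k U₀ hU₀ hα hα3 hα4 h52 hb hsmall hc₃ S hj z κ a
  refine ⟨h.differentiableAt.hasFDerivAt, ?_⟩
  rw [h.fderiv]
  exact norm_snd_fderiv_CCovIter_ins_le L hL hG k U₀ hU₀ hα hα3 hα4 h52 hb hsmall hc₃ h145 h155 S hj z κ a δa

include hL hG hU₀ hα hα3 hα4 h52 hb hsmall hc₃ h145 h155 in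
/-- (149) for `C_j⁽²⁾` in the radius form of `B7Ineq149Pairing.ineq149_pairing`: on `‖a_s‖ ≤ b′` (ANY `b′ ≥ 0`),
`‖D[C_j⁽²⁾(U₀, ins_S ·)(c)](a)δa‖ ≤ C₃·((Lʲ)²b′)·Σ_s kerQdd(c, s)‖δa_s‖`. [cite: Balaban1985Averaging, (149) p.40, (136) p.39] -/
theorem ineq149_secondOrder_of_le {j : ℕ} (hj : j ≤ k) (z : Site d) (κ : Fin d) {b' : ℝ} (hb' : 0 ≤ b') {a : S → 𝔸}
    (ha : ∀ s, ‖a s‖ ≤ b') (δa : S → 𝔸) :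
    ‖fderiv ℂ (fun a' : S → 𝔸 => CCovIter2 L U₀ (insCfg S a') j z κ) a δa‖ ≤
      C3Gen d L * (((L : ℝ) ^ j) ^ 2 * b') * ∑ s : S, kerQdd L j z κ s.1.1 s.1.2 * ‖δa s‖ := by
  have h := (ineq149_secondOrder L hL hG k U₀ hU₀ hα hα3 hα4 h52 hb hsmall hc₃ h145 h155 S hj z κ a δa).2
  have hna : ‖a‖ ≤ b' := (pi_norm_le_iff_of_nonneg hb').2 ha
  have hQ0 : 0 ≤ ∑ s : S, kerQdd L j z κ s.1.1 s.1.2 * ‖δa s‖ :=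
    sum_nonneg fun s _ => mul_nonneg (kerQdd_nonneg L j z κ _ _) (norm_nonneg _)
  have hC := C3Gen_nonneg' d L
  refine h.trans ?_
  have : C3Gen d L * ((L : ℝ) ^ j) ^ 2 * ‖a‖ ≤ C3Gen d L * (((L : ℝ) ^ j) ^ 2 * b') := by
    rw [← mul_assoc]; exact mul_le_mul_of_nonneg_left hna (by positivity)
  exact mul_le_mul_of_nonneg_right this hQ0

include hL hG hU₀ hα hα3 hα4 h52 hb hsmall hc₃ h145 h155 in
/-- (149) for `C_j⁽²⁾` as an OPERATOR BOUND on `𝔸^S` (sup norm): `‖D[C_j⁽²⁾(U₀, ins_S ·)(c)](a)‖ ≤ 2d·C₃·(Lʲ)²·‖a‖` (the count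
`Σ_s kerQdd(c, s) ≤ 2d` of (141)/(142), `B7Ineq149Pairing.sum_kerQdd_mul_norm_le`). [cite: Balaban1985Averaging, (149) p.40, (141)–(142) p.39] -/
theorem opNorm_fderiv_CCovIter2_ins_le {j : ℕ} (hj : j ≤ k) (z : Site d) (κ : Fin d) (a : S → 𝔸) :
    ‖fderiv ℂ (fun a' : S → 𝔸 => CCovIter2 L U₀ (insCfg S a') j z κ) a‖ ≤ 2 * d * (C3Gen d L * ((L : ℝ) ^ j) ^ 2 * ‖a‖) := by
  have hL1 : 1 ≤ L := le_trans (by norm_num) hL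
  have hC := C3Gen_nonneg' d L
  have hK : 0 ≤ C3Gen d L * ((L : ℝ) ^ j) ^ 2 * ‖a‖ := by positivity
  refine ContinuousLinearMap.opNorm_le_bound _ (by positivity) fun v => ?_
  obtain ⟨-, hbd⟩ := ineq149_secondOrder L hL hG k U₀ hU₀ hα hα3 hα4 h52 hb hsmall hc₃ h145 h155 S hj z κ a v
  refine hbd.trans ?_
  calc C3Gen d L * ((L : ℝ) ^ j) ^ 2 * ‖a‖ * ∑ s : S, kerQdd L j z κ s.1.1 s.1.2 * ‖v s‖
      ≤ C3Gen d L * ((L : ℝ) ^ j) ^ 2 * ‖a‖ * (2 * d * ‖v‖) :=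
        mul_le_mul_of_nonneg_left (sum_kerQdd_mul_norm_le S L hL1 j z κ v) hK
    _ = 2 * d * (C3Gen d L * ((L : ℝ) ^ j) ^ 2 * ‖a‖) * ‖v‖ := by ring

include hL hG hU₀ hα hα3 hα4 h52 hb hsmall hc₃ h145 h155 in
/-- **SIZE OF THE SECOND-ORDER TERM**: `‖C_j⁽²⁾(U₀, ins_S a)(c)‖ ≤ ½·C₃·(Lʲ)²·‖a‖·Σ_s kerQdd(c, s)‖a_s‖ ≤ d·C₃·(Lʲ‖a‖)²` (from (149) on
the diagonal; cf. (135) «|C_k(U₀, A)| ≦ C₂|A|²»). [cite: Balaban1985Averaging, (135) p.38, (136) p.39, (149) p.40] -/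
theorem norm_CCovIter2_ins_le {j : ℕ} (hj : j ≤ k) (z : Site d) (κ : Fin d) (a : S → 𝔸) :
    ‖CCovIter2 L U₀ (insCfg S a) j z κ‖ ≤
        2⁻¹ * (C3Gen d L * ((L : ℝ) ^ j) ^ 2 * ‖a‖ * ∑ s : S, kerQdd L j z κ s.1.1 s.1.2 * ‖a s‖) ∧
      ‖CCovIter2 L U₀ (insCfg S a) j z κ‖ ≤ d * (C3Gen d L * ((L : ℝ) ^ j * ‖a‖) ^ 2) := by
  have hL1 : 1 ≤ L := le_trans (by norm_num) hL
  have hC := C3Gen_nonneg' d L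
  have h1 : ‖CCovIter2 L U₀ (insCfg S a) j z κ‖ ≤
      2⁻¹ * (C3Gen d L * ((L : ℝ) ^ j) ^ 2 * ‖a‖ * ∑ s : S, kerQdd L j z κ s.1.1 s.1.2 * ‖a s‖) := by
    rw [CCovIter2_ins_eq L hL hG k U₀ hU₀ hα hα3 hα4 h52 hb hsmall hc₃ S hj z κ a, norm_smul, norm_inv, Complex.norm_ofNat]
    exact mul_le_mul_of_nonneg_left
      (norm_snd_fderiv_CCovIter_ins_le L hL hG k U₀ hU₀ hα hα3 hα4 h52 hb hsmall hc₃ h145 h155 S hj z κ a a) (by norm_num)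
  refine ⟨h1, h1.trans ?_⟩
  have hK : 0 ≤ C3Gen d L * ((L : ℝ) ^ j) ^ 2 * ‖a‖ := by positivity
  have hd : (0 : ℝ) ≤ d := by positivity
  calc 2⁻¹ * (C3Gen d L * ((L : ℝ) ^ j) ^ 2 * ‖a‖ * ∑ s : S, kerQdd L j z κ s.1.1 s.1.2 * ‖a s‖)
      ≤ 2⁻¹ * (C3Gen d L * ((L : ℝ) ^ j) ^ 2 * ‖a‖ * (2 * d * ‖a‖)) :=
        mul_le_mul_of_nonneg_left (mul_le_mul_of_nonneg_left (sum_kerQdd_mul_norm_le S L hL1 j z κ a) hK) (by norm_num)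
    _ = d * (C3Gen d L * ((L : ℝ) ^ j * ‖a‖) ^ 2) := by ring

include hL hG hU₀ hα hα3 hα4 h52 hb hsmall hc₃ in
/-- **`C_j⁽²⁾` IS HOMOGENEOUS OF DEGREE TWO** («homogeneous polynomials», (136)): `C_j⁽²⁾(U₀, ins_S(t·a))(c) = t²·C_j⁽²⁾(U₀, ins_S a)(c)`.
[cite: Balaban1985Averaging, (136) p.39] -/
theorem CCovIter2_ins_smul {j : ℕ} (hj : j ≤ k) (z : Site d) (κ : Fin d) (t : ℂ) (a : S → 𝔸) :
    CCovIter2 L U₀ (insCfg S (t • a)) j z κ = t ^ 2 • CCovIter2 L U₀ (insCfg S a) j z κ := by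
  rw [CCovIter2_ins_eq L hL hG k U₀ hU₀ hα hα3 hα4 h52 hb hsmall hc₃ S hj z κ (t • a),
    CCovIter2_ins_eq L hL hG k U₀ hU₀ hα hα3 hα4 h52 hb hsmall hc₃ S hj z κ a, map_smul, map_smul,
    smul_apply, smul_smul, smul_smul, smul_smul]
  congr 1
  ring

end Regime

end Literature.MathematicalPhysics.QuantumFieldTheory.Balaban1983to89.B7Eq136SecondOrder

end
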